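import Literature.IUT.HodgeArakelov.ThetaSettingHextPureExtensionAtModelTate
import Literature.IUT.HodgeArakelov.ThetaSettingHextFamiliesAtModelTate
import Literature.AnabelianGeometry.EtaleTheta.SettingModelTateCusp
import Literature.AnabelianGeometry.EtaleTheta.SettingModelChiTwistedSections
import Literature.AnabelianGeometry.EtaleTheta.SettingModelGfpLevelKernelRigidity
import HarnessLib

/-!
# The extension property `hextΔ` at the stage-2 Tate model: REDUCTION OF THE QUANTIFIER DOMAIN TO GALOIS-TRIVIAL `γ`
# (proof-only; K-L6 row «HEXT-GALOIS-REDUCE@modelTate» — the last hextΔ instrument under the moratorium)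

S. Mochizuki, *The étale theta function and its Frobenioid-theoretic manifestations* [EtTh], Publ. RIMS **45** (2009) (refereed), §2,
Prop. 2.4 p. 38 (every automorphism of `Π^tp_{X̲̲}` arises from one of `Π^tp_X`) [cite: MochizukiEtTh2009, Prop 2.4 p.38]; §1 p. 13 (the Galois
action on `Π^tp_X` through the Kummer class `κ_p` and the cyclotomic character `χ`); [AbsAnab] Prop. 1.2.1 (vi)–(vii) (the cyclotomic character
and the Kummer theory of an MLF are group-theoretic) [cite: MochizukiAbsAnab2004, Prop 1.2.1 p.9].

Cell `abc-iut`, seat abc-iut-L6-t13 (gen 13; abc-iut-L6-lead §F v1.19er (A) KEY «HEXT-GALOIS-REDUCE@modelTate», sizing line 07:2xZ).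
PROOF-ONLY companion of this seat's files p502505 / p504488 / p506309 (★ `hext_at_iff_exists_f2hatAut_pure`), of abc-iut-w5-d169's (K1)
`hext_at_symm` / `hext_at_trans` (p496371) and reduction p497819/p498683, and of abc-iut-w5-d125's Galois-trivial PAIRS (p503499 — cited BY
NAME, not restated): NO definition, NO instance, NO new named fact.

THE DISPLAYED HYPOTHESIS (ONE per `γ`, the weakest clause actually used; standard form):
  **(hK)** `∃ (v : MulAut Ẑ) (t₀ : Ẑ), ∀ σ, tatePairHom p i j (ν_γ σ) = ⟨(t₀^i, t₀^j), v⟩ · tatePairHom p i j σ · ⟨(t₀^i, t₀^j), v⟩⁻¹`,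
where `ν_γ σ := (γ (inr σ)).right` is the Galois part of `γ` (§1): «the Galois part of `γ` acts on the Tate–Kummer pair `(κ_p, χ)` through
conjugation by an element of the structure group `(Ẑ × Ẑ) ⋊ Ẑ^×` lying over the `(i, j)`-diagonal», i.e. `κ_p ∘ ν_γ = v·κ_p + (1 − χ)·t₀` and
`χ ∘ ν_γ = χ` (the latter because `Ẑ^×` is abelian — so `hχ` is NOT a separate binder).  (hK) is EXACTLY the conclusion of the desk theorem
HEXT-RZETA-D2 (I) of this seat (HOME/staging/L6/L6-t13/gen13/HEXT-RZETA-D2.md, 2026-08-27): there it is DERIVED from two PRINT facts about the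
genuine `G_{ℚ_p}` that are NOT in the tree — local Kronecker–Weber (`p^{1/N} ∈ ℚ_p(μ_∞) ⟺ N ∣ p − 1`, so `im tatePairHom ∩ (Ẑ × 1) = (p−1)Ẑ`)
and the Kummer independence of `p` and `μ_{p−1}` in `ℚ_p^×/(ℚ_p^×)^{p−1}` ([AbsAnab] Prop. 1.2.1 (vi)(vii) species), together with the spectrum of
the Tate action on `Û^{ab} ⊗ ℚ`.  Here (hK) is carried as a hypothesis; no local class field theory enters this file.

WHAT THIS FILE PROVES (EVERY prime `p`, EVERY `i j`, EVERY étale-theta datum over `modelχq p i j`, EVERY `X̲̲`-choice of the displayed shape with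
`l` odd; the [IUTchII] §1 side hypotheses `l` prime, `p ≠ 2`, `p ≠ l`, `ζ_{4l} ∈ ℚ_p` feed (D) = p488629 exactly as in p506309).
* §1 `right_coe_apply_eq_right_inr` — `(γ h).right = (γ (inr h.right)).right` for every `h ∈ Π^tp_{X̲̲}` ((D) of p506309: `γ (inl d)` has
  trivial Galois coordinate); `exists_galoisPart` — the GALOIS PART `ν_γ : G_{ℚ_p} ≃ₜ* G_{ℚ_p}` of `γ`, a bi-continuous automorphism with
  `(γ h).right = ν_γ (h.right)` (inverse read off `γ⁻¹`).
* §2 `affTwist₃Gfp_mem_dUU` — every element of the structure group `(Ẑ × Ẑ) ⋊ Ẑ^×` maps `dUU l` into itself (`l` odd: the level-`l` shadow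
  of `affTwist₃Gfp g` is an endomorphism of `Heis(ℤ/l)` by p496682 `exists_monoidHom_levelHom_comp_eq`, and on the `b`-axis it is
  `b^t ↦ b^{g.right t}` by `affTwist₃Gfp_bPowGfp`); `exists_extension_of_hK` — **THE EXTENDABLE COMPANION**: under (hK), with
  `Φ₀ := affTwist₃Gfp ⟨(t₀^i, t₀^j), v⟩` (a composite of the three landed extendable families: cyclotomic twist `θ_v`, `F̂₂`-inner `Inn(b^{t₀})`,
  shear), `Γ₀ := (Φ₀, ν_γ)` is a `Δ^tp_X`-stabilising bi-continuous automorphism of `Π^tp_X = Γ ⋊ G_{ℚ_p}` (one line: `affTwist₃Gfp` is a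
  homomorphism, so (hK) IS the semidirect compatibility) carrying `Π^tp_{X̲̲}` onto itself; its restriction `γ₀` satisfies `hextΔ(γ₀)` by
  construction and has the SAME Galois part `ν_γ`.
* §3 ★ `exists_extendable_galoisTrivial_factor` — under (hK): `∃ γ₀` with `hextΔ(γ₀)`, `γ₁ := γ₀⁻¹ ∘ γ` GALOIS-TRIVIAL (`(γ₁ h).right = h.right`,
  i.e. `γ₁` is a pair `(φ, e)` of p503499), and `hextΔ(γ) ⟺ hextΔ(γ₁)` ((K1) `hext_at_symm` / `hext_at_trans`).
* §4 ★ `hext_of_forall_galoisTrivial_of_hK` — **THE QUANTIFIER-DOMAIN REDUCTION**: if (hK) holds for every `γ` and `hextΔ(γ₁)` holds for every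
  GALOIS-TRIVIAL `γ₁`, then `hextΔ(γ)` holds for EVERY `γ`; with p503499 (`exists_pair_of_forall_right_eq`, `hext_at_iff_of_pair`) the binder of
  record reads «every T-pair's `φ` lifts to `Aut_top(Γ)`», modulo the displayed (hK).
CONSEQUENCE FOR THE K-L6 CELL (honest words): the token clause «Galois-non-trivial γ untouched» becomes «reduced to T-pairs IN KERNEL modulo (hK);
(hK) = desk theorem HEXT-RZETA-D2 (I) from local Kronecker–Weber + Kummer independence (print facts, not in tree)».  Neither direction of
`hextΔ` is claimed; nothing here decides whether every pair's `φ` lifts.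

HONEST LABEL. `modelχq` is a SEMI-SYNTHETIC model of the typed [EtTh] §1 interface (not the tempered `π₁` of a curve): statements about OUR
model and OUR typed binder only; nothing of [EtTh] / [IUTchII] (claim key `Mochizuki2012`, DISPUTED, D-0012) is asserted; no side is taken on
[IUTchIII] Cor. 3.12; typed ≠ proved; nothing here bears on whether abc is proved or refuted.
bears_on: LADDER-ABC:A2.L-K (K-L6 «HEXT-DECIDE@modelχq») → LADDER-FRONTIER F-A2 (M·L6) → rung 0 `Summit.ABC`.
-/

set_option autoImplicit false

noncomputable section

namespace Literature.AnabelianGeometry.EtaleTheta.SettingModel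

open Literature.AnabelianGeometry.SemiGraphs
open Literature.IUT.HodgeArakelov
open Function
open _root_.Topology

/-! ## §2 (first, action-only). The structure group preserves `dUU l` (`l` odd) -/

/-- **Every `affTwist₃Gfp g` (cyclotomic twist ∘ shear ∘ `F̂₂`-inner by a `b`-power) maps `dUU l` into itself for odd `l`.**  Its level-`l`
shadow is an endomorphism `ε` of `Heis(ℤ/l)` (p496682), and `levelHom l d = (0, y, 0) = levelHom l (b^t)` for `d ∈ dUU l`, while
`affTwist₃Gfp g (b^t) = b^{g.right t}` has `x = z = 0`. [cite: MochizukiEtTh2009, Def 2.5 (i) p.39] -/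
theorem affTwist₃Gfp_mem_dUU (l' : ℕ+) (hl' : Odd (l' : ℕ)) (g : (ZH × ZH) ⋊[diagAut] MulAut ZH) {d : Gfp}
    (hd : d ∈ dUU l') : affTwist₃Gfp g d ∈ dUU l' := by
  haveI : NeZero (l' : ℕ) := ⟨PNat.ne_zero l'⟩
  let φ : Gfp →ₜ* Gfp := ⟨(affTwist₃Gfp g).toMonoidHom, continuous_affTwist₃Gfp g⟩
  obtain ⟨ε, hε⟩ := exists_monoidHom_levelHom_comp_eq φ l' hl'
  obtain ⟨hx, hz⟩ := (mem_dUU_iff l' d).1 hd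
  -- `levelHom l d = levelHom l (b^t)` with `t := ι (y.val)`
  set y : ZMod l' := (levelHom l' d).y with hy
  let t : ZH := iotaZ (Multiplicative.ofAdd (y.val : ℤ))
  have hlev : levelHom l' d = levelHom l' (bPowGfp t) := by
    rw [levelHom_bPowGfp, ← modN_eq_level, modN_iotaZ, toAdd_ofAdd, toAdd_ofAdd, Int.cast_natCast, ZMod.natCast_zmod_val]
    ext
    · exact hx
    · rfl
    · exact hz
  -- hence `levelHom l (φ d) = levelHom l (φ (b^t)) = levelHom l (b^{g.right t})`
  have key : levelHom l' (affTwist₃Gfp g d) = levelHom l' (bPowGfp (g.right t)) := by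
    rw [← affTwist₃Gfp_bPowGfp g t]
    change levelHom l' (φ d) = levelHom l' (φ (bPowGfp t))
    rw [hε, hε, hlev]
  rw [mem_dUU_iff, key, levelHom_bPowGfp]
  exact ⟨rfl, rfl⟩

variable {p : ℕ} [Fact p.Prime] {i j : ℤ} {hj : Even j} {E : (ThetaSetting.modelχq p i j hj).EtaleThetaData} {l : ℕ}
  (C : E.DoubleUnderline l) {l' : ℕ+}
  (hinl : ∀ d ∈ dUU l', (SemidirectProduct.inl d : PiTpχq p i j) ∈ C.Huu)
  (hinr : ∀ σ : GQp p, (SemidirectProduct.inr σ : PiTpχq p i j) ∈ C.Huu)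
  (hleft : ∀ h ∈ C.Huu, (h : PiTpχq p i j).left ∈ dUU l')
  (hl : l.Prime) (hp2 : p ≠ 2) (hpl : p ≠ l) (hζ : ∃ ζ : (ThetaSetting.modelχq p i j hj).K, IsPrimitiveRoot ζ (4 * l))

/-! ## §1. The Galois part `ν_γ` of an automorphism `γ` of `Π^tp_{X̲̲}` -/

include hinl hinr hleft hl hp2 hpl hζ in
/-- **The Galois coordinate of `γ h` only depends on the Galois coordinate of `h`**: `(γ h).right = (γ (inr h.right)).right`
(`h = inl h.left · inr h.right` and `γ (inl h.left)` has trivial Galois coordinate by (D), p506309). [cite: MochizukiEtTh2009, Prop 2.4 p.38] -/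
theorem right_coe_apply_eq_right_inr (γ : ↥C.Huu ≃ₜ* ↥C.Huu) (h : C.Huu) :
    ((γ h : C.Huu) : PiTpχq p i j).right =
      ((γ ⟨SemidirectProduct.inr (h : PiTpχq p i j).right, hinr _⟩ : C.Huu) : PiTpχq p i j).right := by
  have hdec : h = ⟨SemidirectProduct.inl (h : PiTpχq p i j).left, hinl _ (hleft _ h.2)⟩ *
      ⟨SemidirectProduct.inr (h : PiTpχq p i j).right, hinr _⟩ :=
    Subtype.ext (SemidirectProduct.inl_left_mul_inr_right (h : PiTpχq p i j)).symm
  conv_lhs => rw [hdec, map_mul]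
  change (((γ _ : C.Huu) : PiTpχq p i j) * ((γ _ : C.Huu) : PiTpχq p i j)).right = _
  rw [SemidirectProduct.mul_right, right_apply_inl_eq_one C hinl hl hp2 hpl hζ γ _ (hleft _ h.2), one_mul]

include hinl hinr hleft hl hp2 hpl hζ in
/-- **THE GALOIS PART `ν_γ` OF `γ`**: a bi-continuous automorphism `ν` of `G_{ℚ_p}` with `(γ h).right = ν (h.right)` for every
`h ∈ Π^tp_{X̲̲}`; explicitly `ν σ = (γ (inr σ)).right`, `ν⁻¹ σ = (γ⁻¹ (inr σ)).right`. [cite: MochizukiEtTh2009, Prop 2.4 p.38] -/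
theorem exists_galoisPart (γ : ↥C.Huu ≃ₜ* ↥C.Huu) :
    ∃ ν : GQp p ≃ₜ* GQp p,
      (∀ σ, ν σ = ((γ ⟨SemidirectProduct.inr σ, hinr σ⟩ : C.Huu) : PiTpχq p i j).right) ∧
        ∀ h : C.Huu, ((γ h : C.Huu) : PiTpχq p i j).right = ν ((h : PiTpχq p i j).right) := by
  let f : GQp p → GQp p := fun σ => ((γ ⟨SemidirectProduct.inr σ, hinr σ⟩ : C.Huu) : PiTpχq p i j).right
  let f' : GQp p → GQp p := fun σ => ((γ.symm ⟨SemidirectProduct.inr σ, hinr σ⟩ : C.Huu) : PiTpχq p i j).right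
  have hf : ∀ h : C.Huu, ((γ h : C.Huu) : PiTpχq p i j).right = f ((h : PiTpχq p i j).right) :=
    right_coe_apply_eq_right_inr C hinl hinr hleft hl hp2 hpl hζ γ
  have hf' : ∀ h : C.Huu, ((γ.symm h : C.Huu) : PiTpχq p i j).right = f' ((h : PiTpχq p i j).right) :=
    right_coe_apply_eq_right_inr C hinl hinr hleft hl hp2 hpl hζ γ.symm
  have hmul : ∀ σ τ, f (σ * τ) = f σ * f τ := fun σ τ => by
    have hprod : (⟨SemidirectProduct.inr (σ * τ), hinr (σ * τ)⟩ : C.Huu) =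
        ⟨SemidirectProduct.inr σ, hinr σ⟩ * ⟨SemidirectProduct.inr τ, hinr τ⟩ := Subtype.ext (map_mul _ σ τ)
    change ((γ ⟨SemidirectProduct.inr (σ * τ), hinr (σ * τ)⟩ : C.Huu) : PiTpχq p i j).right = _
    rw [hprod, map_mul]
    exact SemidirectProduct.mul_right _ _
  have hcr : Continuous fun x : PiTpχq p i j => x.right := Semidirect.continuous_right (isInducing_leftRightχq p i j)
  have hfc : Continuous f :=
    hcr.comp (continuous_subtype_val.comp (γ.continuous.comp ((continuous_inrχq p i j).subtype_mk _)))
  have hf'c : Continuous f' :=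
    hcr.comp (continuous_subtype_val.comp (γ.symm.continuous.comp ((continuous_inrχq p i j).subtype_mk _)))
  have h1 : ∀ σ, f' (f σ) = σ := fun σ => by
    have h := hf' (γ ⟨SemidirectProduct.inr σ, hinr σ⟩)
    rw [γ.symm_apply_apply] at h
    exact h.symm.trans (SemidirectProduct.right_inr σ)
  have h2 : ∀ σ, f (f' σ) = σ := fun σ => by
    have h := hf (γ.symm ⟨SemidirectProduct.inr σ, hinr σ⟩)
    rw [γ.apply_symm_apply] at h
    exact h.symm.trans (SemidirectProduct.right_inr σ)
  let ν : GQp p ≃ₜ* GQp p :=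
    { toFun := f
      invFun := f'
      left_inv := h1
      right_inv := h2
      map_mul' := hmul
      continuous_toFun := hfc
      continuous_invFun := hf'c }
  exact ⟨ν, fun σ => rfl, hf⟩

/-! ## §2. The extendable companion `γ₀` under (hK) -/

include hinl hinr hleft hl hp2 hpl hζ in
/-- **THE EXTENDABLE COMPANION.**  Under (hK) — the Galois part of `γ` conjugates the Tate–Kummer pair by
`g₀ := ⟨(t₀^i, t₀^j), v⟩ ∈ (Ẑ × Ẑ) ⋊ Ẑ^×` — the pair `(Φ₀ := affTwist₃Gfp g₀, ν_γ)` defines a bi-continuous automorphism `Γ₀` of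
`Π^tp_X = Γ ⋊ G_{ℚ_p}` which stabilises `Δ^tp_X = inl Γ`, carries `Π^tp_{X̲̲}` onto itself, and has the SAME Galois part as `γ`:
`(Γ₀ h).right = (γ h).right`.  (`Φ₀` is a composite of the three landed extendable families: twist, `b`-power conjugation, shear.)
[cite: MochizukiEtTh2009, Prop 2.4 p.38] -/
theorem exists_extension_of_hK (hl' : Odd (l' : ℕ)) (γ : ↥C.Huu ≃ₜ* ↥C.Huu)
    (hK : ∃ (v : MulAut ZH) (t₀ : ZH), ∀ σ : GQp p,
      tatePairHom p i j (((γ ⟨SemidirectProduct.inr σ, hinr σ⟩ : C.Huu) : PiTpχq p i j).right) =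
        (⟨(t₀ ^ i, t₀ ^ j), v⟩ : (ZH × ZH) ⋊[diagAut] MulAut ZH) * tatePairHom p i j σ *
          (⟨(t₀ ^ i, t₀ ^ j), v⟩ : (ZH × ZH) ⋊[diagAut] MulAut ZH)⁻¹) :
    ∃ Γ₀ : PiTpχq p i j ≃ₜ* PiTpχq p i j,
      (curveχq p i j).DeltaTemp.map Γ₀.toMulEquiv.toMonoidHom = (curveχq p i j).DeltaTemp ∧
      (∀ h : C.Huu, Γ₀ (h : PiTpχq p i j) ∈ C.Huu) ∧ (∀ h : C.Huu, Γ₀.symm (h : PiTpχq p i j) ∈ C.Huu) ∧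
      ∀ h : C.Huu, (Γ₀ (h : PiTpχq p i j)).right = ((γ h : C.Huu) : PiTpχq p i j).right := by
  obtain ⟨ν, hν, hνr⟩ := exists_galoisPart C hinl hinr hleft hl hp2 hpl hζ γ
  obtain ⟨v, t₀, hK⟩ := hK
  set g₀ : (ZH × ZH) ⋊[diagAut] MulAut ZH := ⟨(t₀ ^ i, t₀ ^ j), v⟩ with hg₀
  -- the semidirect compatibility IS (hK)
  have hcompat : ∀ σ : GQp p, (actχq p i j σ).trans (affTwist₃Gfp g₀) =
      (affTwist₃Gfp g₀).trans (actχq p i j (ν.toMulEquiv σ)) := fun σ => by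
    apply MulEquiv.ext
    intro n
    change affTwist₃Gfp g₀ (affTwist₃Gfp (tatePairHom p i j σ) n) =
      affTwist₃Gfp (tatePairHom p i j (ν σ)) (affTwist₃Gfp g₀ n)
    rw [← MulAut.mul_apply, ← map_mul, ← MulAut.mul_apply, ← map_mul, hν σ, hK σ, inv_mul_cancel_right]
  let Γm : PiTpχq p i j ≃* PiTpχq p i j := SemidirectProduct.congr (affTwist₃Gfp g₀) ν.toMulEquiv hcompat
  have hΓm : ∀ x : PiTpχq p i j, Γm x = ⟨affTwist₃Gfp g₀ x.left, ν x.right⟩ := fun _ => rfl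
  have hΓm' : ∀ x : PiTpχq p i j, Γm.symm x = ⟨(affTwist₃Gfp g₀).symm x.left, ν.symm x.right⟩ := fun _ => rfl
  -- continuity (topology induced by `(left, right)`)
  have hcl : Continuous fun x : PiTpχq p i j => x.left := Semidirect.continuous_left (isInducing_leftRightχq p i j)
  have hcr : Continuous fun x : PiTpχq p i j => x.right := Semidirect.continuous_right (isInducing_leftRightχq p i j)
  have hsymm_cont : Continuous fun n : Gfp => (affTwist₃Gfp g₀).symm n := by
    have : ((affTwist₃Gfp g₀).symm : Gfp → Gfp) = affTwist₃Gfp g₀⁻¹ := by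
      funext n; rw [map_inv]; rfl
    rw [this]; exact continuous_affTwist₃Gfp g₀⁻¹
  have hc : Continuous Γm := by
    rw [(isInducing_leftRightχq p i j).continuous_iff]
    exact ((continuous_affTwist₃Gfp g₀).comp hcl).prodMk (ν.continuous.comp hcr)
  have hc' : Continuous Γm.symm := by
    rw [(isInducing_leftRightχq p i j).continuous_iff]
    exact (hsymm_cont.comp hcl).prodMk (ν.symm.continuous.comp hcr)
  let Γ₀ : PiTpχq p i j ≃ₜ* PiTpχq p i j := { Γm with continuous_toFun := hc, continuous_invFun := hc' }
  have hΓ₀ : ∀ x : PiTpχq p i j, Γ₀ x = ⟨affTwist₃Gfp g₀ x.left, ν x.right⟩ := hΓm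
  have hΓ₀' : ∀ x : PiTpχq p i j, Γ₀.symm x = ⟨(affTwist₃Gfp g₀).symm x.left, ν.symm x.right⟩ := hΓm'
  -- membership in `Π^tp_{X̲̲}`: `⟨d, σ⟩ = inl d · inr σ` with `d ∈ dUU l`
  have hmem : ∀ (d : Gfp) (σ : GQp p), d ∈ dUU l' → (⟨d, σ⟩ : PiTpχq p i j) ∈ C.Huu := fun d σ hd => by
    rw [← SemidirectProduct.inl_left_mul_inr_right (⟨d, σ⟩ : PiTpχq p i j)]
    exact C.Huu.mul_mem (hinl d hd) (hinr σ)
  have hsymm_mem : ∀ {d : Gfp}, d ∈ dUU l' → (affTwist₃Gfp g₀).symm d ∈ dUU l' := fun {d} hd => by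
    have : (affTwist₃Gfp g₀).symm d = affTwist₃Gfp g₀⁻¹ d := by rw [map_inv]; rfl
    rw [this]; exact affTwist₃Gfp_mem_dUU l' hl' g₀⁻¹ hd
  refine ⟨Γ₀, ?_, fun h => ?_, fun h => ?_, fun h => ?_⟩
  · -- `Δ^tp_X`-stability: the Galois coordinate of `Γ₀ x` is `ν x.right`
    ext x
    constructor
    · rintro ⟨y, hy, rfl⟩
      rw [SetLike.mem_coe, mem_deltaTempχq_iff] at hy
      change Γ₀ y ∈ (curveχq p i j).DeltaTemp
      rw [mem_deltaTempχq_iff, hΓ₀, hy, map_one]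
    · intro hx
      refine ⟨Γ₀.symm x, ?_, Γ₀.apply_symm_apply x⟩
      rw [mem_deltaTempχq_iff] at hx
      rw [SetLike.mem_coe, mem_deltaTempχq_iff, hΓ₀', hx, map_one]
  · rw [hΓ₀]; exact hmem _ _ (affTwist₃Gfp_mem_dUU l' hl' g₀ (hleft _ h.2))
  · rw [hΓ₀']; exact hmem _ _ (hsymm_mem (hleft _ h.2))
  · rw [hΓ₀, hνr h]

/-! ## §3. Every `γ` is an extendable automorphism times a Galois-trivial one -/

include hinl hinr hleft hl hp2 hpl hζ in
/-- ★ **FACTORISATION `γ = γ₀ ∘ γ₁` WITH `γ₀` EXTENDABLE AND `γ₁` GALOIS-TRIVIAL** (under (hK), `l` odd): there is a bi-continuous automorphism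
`γ₀` of `Π^tp_{X̲̲}` with `hextΔ(γ₀)`, such that `γ₁ := γ₀⁻¹ ∘ γ` satisfies `(γ₁ h).right = h.right` for all `h` (a Galois-trivial pair of
p503499) and `hextΔ(γ) ⟺ hextΔ(γ₁)`. [cite: MochizukiEtTh2009, Prop 2.4 p.38] -/
theorem exists_extendable_galoisTrivial_factor (hl' : Odd (l' : ℕ)) (γ : ↥C.Huu ≃ₜ* ↥C.Huu)
    (hK : ∃ (v : MulAut ZH) (t₀ : ZH), ∀ σ : GQp p,
      tatePairHom p i j (((γ ⟨SemidirectProduct.inr σ, hinr σ⟩ : C.Huu) : PiTpχq p i j).right) =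
        (⟨(t₀ ^ i, t₀ ^ j), v⟩ : (ZH × ZH) ⋊[diagAut] MulAut ZH) * tatePairHom p i j σ *
          (⟨(t₀ ^ i, t₀ ^ j), v⟩ : (ZH × ZH) ⋊[diagAut] MulAut ZH)⁻¹) :
    ∃ γ₀ : ↥C.Huu ≃ₜ* ↥C.Huu,
      (∃ Γ : PiTpχq p i j ≃ₜ* PiTpχq p i j,
        (∀ h : C.Huu, Γ (h : PiTpχq p i j) = ((γ₀ h : C.Huu) : PiTpχq p i j)) ∧
          (curveχq p i j).DeltaTemp.map Γ.toMulEquiv.toMonoidHom = (curveχq p i j).DeltaTemp) ∧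
      (∀ h : C.Huu, (((γ₀.symm.trans γ) h : C.Huu) : PiTpχq p i j).right = (h : PiTpχq p i j).right) ∧
      ((∃ Γ : PiTpχq p i j ≃ₜ* PiTpχq p i j,
          (∀ h : C.Huu, Γ (h : PiTpχq p i j) = ((γ h : C.Huu) : PiTpχq p i j)) ∧
            (curveχq p i j).DeltaTemp.map Γ.toMulEquiv.toMonoidHom = (curveχq p i j).DeltaTemp) ↔
        (∃ Γ : PiTpχq p i j ≃ₜ* PiTpχq p i j,
          (∀ h : C.Huu, Γ (h : PiTpχq p i j) = (((γ₀.symm.trans γ) h : C.Huu) : PiTpχq p i j)) ∧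
            (curveχq p i j).DeltaTemp.map Γ.toMulEquiv.toMonoidHom = (curveχq p i j).DeltaTemp)) := by
  obtain ⟨Γ₀, hΔ, hin, hin', hright⟩ := exists_extension_of_hK C hinl hinr hleft hl hp2 hpl hζ hl' γ hK
  -- restrict `Γ₀` to `Π^tp_{X̲̲}`
  let γ₀ : ↥C.Huu ≃ₜ* ↥C.Huu :=
    { toFun := fun h => ⟨Γ₀ h, hin h⟩
      invFun := fun h => ⟨Γ₀.symm h, hin' h⟩
      left_inv := fun h => Subtype.ext (Γ₀.symm_apply_apply _)
      right_inv := fun h => Subtype.ext (Γ₀.apply_symm_apply _)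
      map_mul' := fun a b => Subtype.ext (map_mul Γ₀ _ _)
      continuous_toFun := (Γ₀.continuous.comp continuous_subtype_val).subtype_mk _
      continuous_invFun := (Γ₀.symm.continuous.comp continuous_subtype_val).subtype_mk _ }
  have hγ₀ : ∀ h : C.Huu, Γ₀ (h : PiTpχq p i j) = ((γ₀ h : C.Huu) : PiTpχq p i j) := fun _ => rfl
  have hext₀ : ∃ Γ : PiTpχq p i j ≃ₜ* PiTpχq p i j,
      (∀ h : C.Huu, Γ (h : PiTpχq p i j) = ((γ₀ h : C.Huu) : PiTpχq p i j)) ∧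
        (curveχq p i j).DeltaTemp.map Γ.toMulEquiv.toMonoidHom = (curveχq p i j).DeltaTemp := ⟨Γ₀, hγ₀, hΔ⟩
  refine ⟨γ₀, hext₀, fun h => ?_, ⟨fun hγ => ?_, fun hγ₁ => ?_⟩⟩
  · -- Galois-triviality of `γ₁ = γ₀⁻¹ ∘ γ`: both `γ` and `γ₀` have Galois part `ν`
    change (((γ (γ₀.symm h)) : C.Huu) : PiTpχq p i j).right = _
    have h1 := hright (γ₀.symm h)
    rw [hγ₀, γ₀.apply_symm_apply] at h1
    exact h1.symm
  · exact hext_at_trans C (γ₀.symm) γ (hext_at_symm C γ₀ hext₀) hγ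
  · have h := hext_at_trans C γ₀ (γ₀.symm.trans γ) hext₀ hγ₁
    have heq : γ₀.trans (γ₀.symm.trans γ) = γ :=
      ContinuousMulEquiv.ext fun h => congrArg γ (γ₀.symm_apply_apply h)
    rwa [heq] at h

/-! ## §4. The quantifier-domain reduction -/

include hinl hinr hleft hl hp2 hpl hζ in
/-- ★ **`hextΔ` FOR ALL `γ` FROM `hextΔ` FOR GALOIS-TRIVIAL `γ`, modulo (hK).**  If (hK) holds for every `γ` (desk theorem HEXT-RZETA-D2 (I),
from local Kronecker–Weber + Kummer independence — print facts about `G_{ℚ_p}`, displayed) and every GALOIS-TRIVIAL bi-continuous automorphism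
of `Π^tp_{X̲̲}` extends (`hextΔ(γ₁)` whenever `(γ₁ h).right = h.right` for all `h` — by p503499 exactly «every T-pair's `φ` lifts to
`Aut_top(Γ)`»), then `hextΔ(γ)` holds for EVERY `γ`.  Neither hypothesis is claimed. [cite: MochizukiEtTh2009, Prop 2.4 p.38] -/
theorem hext_of_forall_galoisTrivial_of_hK (hl' : Odd (l' : ℕ))
    (hKall : ∀ γ : ↥C.Huu ≃ₜ* ↥C.Huu, ∃ (v : MulAut ZH) (t₀ : ZH), ∀ σ : GQp p,
      tatePairHom p i j (((γ ⟨SemidirectProduct.inr σ, hinr σ⟩ : C.Huu) : PiTpχq p i j).right) =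
        (⟨(t₀ ^ i, t₀ ^ j), v⟩ : (ZH × ZH) ⋊[diagAut] MulAut ZH) * tatePairHom p i j σ *
          (⟨(t₀ ^ i, t₀ ^ j), v⟩ : (ZH × ZH) ⋊[diagAut] MulAut ZH)⁻¹)
    (htriv : ∀ γ₁ : ↥C.Huu ≃ₜ* ↥C.Huu, (∀ h : C.Huu, ((γ₁ h : C.Huu) : PiTpχq p i j).right = (h : PiTpχq p i j).right) →
      ∃ Γ : PiTpχq p i j ≃ₜ* PiTpχq p i j,
        (∀ h : C.Huu, Γ (h : PiTpχq p i j) = ((γ₁ h : C.Huu) : PiTpχq p i j)) ∧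
          (curveχq p i j).DeltaTemp.map Γ.toMulEquiv.toMonoidHom = (curveχq p i j).DeltaTemp)
    (γ : ↥C.Huu ≃ₜ* ↥C.Huu) :
    ∃ Γ : PiTpχq p i j ≃ₜ* PiTpχq p i j,
      (∀ h : C.Huu, Γ (h : PiTpχq p i j) = ((γ h : C.Huu) : PiTpχq p i j)) ∧
        (curveχq p i j).DeltaTemp.map Γ.toMulEquiv.toMonoidHom = (curveχq p i j).DeltaTemp := by
  obtain ⟨γ₀, -, htr, hiff⟩ := exists_extendable_galoisTrivial_factor C hinl hinr hleft hl hp2 hpl hζ hl' γ (hKall γ)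
  exact hiff.2 (htriv _ htr)

include hinl hinr hleft in
/-- **The reduction AT THE DATUM OF RECORD** (`l` prime with `4·l ∣ p − 1`; side hypotheses are the tree's
`ModelTateCarriers.ne_two_of_four_mul_dvd_pred` / `…ne_of_four_mul_dvd_pred` / `…exists_isPrimitiveRoot_K_modelχq`).
[cite: MochizukiEtTh2009, Prop 2.4 p.38] -/
theorem hext_of_forall_galoisTrivial_of_hK_record (hlp : l.Prime) (hdvd : 4 * l ∣ p - 1) (hl' : Odd (l' : ℕ))
    (hKall : ∀ γ : ↥C.Huu ≃ₜ* ↥C.Huu, ∃ (v : MulAut ZH) (t₀ : ZH), ∀ σ : GQp p,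
      tatePairHom p i j (((γ ⟨SemidirectProduct.inr σ, hinr σ⟩ : C.Huu) : PiTpχq p i j).right) =
        (⟨(t₀ ^ i, t₀ ^ j), v⟩ : (ZH × ZH) ⋊[diagAut] MulAut ZH) * tatePairHom p i j σ *
          (⟨(t₀ ^ i, t₀ ^ j), v⟩ : (ZH × ZH) ⋊[diagAut] MulAut ZH)⁻¹)
    (htriv : ∀ γ₁ : ↥C.Huu ≃ₜ* ↥C.Huu, (∀ h : C.Huu, ((γ₁ h : C.Huu) : PiTpχq p i j).right = (h : PiTpχq p i j).right) →
      ∃ Γ : PiTpχq p i j ≃ₜ* PiTpχq p i j,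
        (∀ h : C.Huu, Γ (h : PiTpχq p i j) = ((γ₁ h : C.Huu) : PiTpχq p i j)) ∧
          (curveχq p i j).DeltaTemp.map Γ.toMulEquiv.toMonoidHom = (curveχq p i j).DeltaTemp)
    (γ : ↥C.Huu ≃ₜ* ↥C.Huu) :
    ∃ Γ : PiTpχq p i j ≃ₜ* PiTpχq p i j,
      (∀ h : C.Huu, Γ (h : PiTpχq p i j) = ((γ h : C.Huu) : PiTpχq p i j)) ∧
        (curveχq p i j).DeltaTemp.map Γ.toMulEquiv.toMonoidHom = (curveχq p i j).DeltaTemp :=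
  hext_of_forall_galoisTrivial_of_hK C hinl hinr hleft hlp (ModelTateCarriers.ne_two_of_four_mul_dvd_pred p hlp.pos hdvd)
    (ModelTateCarriers.ne_of_four_mul_dvd_pred p hlp.pos hdvd)
    (ModelTateCarriers.exists_isPrimitiveRoot_K_modelχq p i j hj hlp.pos hdvd) hl' hKall htriv γ

end Literature.AnabelianGeometry.EtaleTheta.SettingModel

end
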